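import Summits.CriticalPhenomena.PercolationContinuityZ3.Theorems.Transplant.KNCells2CorridorEdge
import HarnessLib

/-!
# Design (D), order D8 (lead 14:14:51Z): the ROOT PROBE input `hQ0` of `theta_pos_of_kit₂'` / `KitAt` from a chain of target steps
# (KN's `G₀` step: the root cube `Q_0` is wired by the initial event; a first hop from the wired cube to the first fresh core — the instance's
# monotone-wired Lemma 9-prod, p3-g2's `link_seed_center_of_le` — is the SOURCE bound `hsrc`; then the corridor chain through `E_{0,du}` to `M_{du}`
# under the law `pinW lattW U₀ U₀` restricted to `U = Q_0 ∪ E_{0,du}`)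

builds on p205010 (kernel theorem, internal audit signed; external expert review pending) — nothing in this file uses p205010.
Lane `prim-bschramm`, seat `prim-bschramm-p2` (G4/D8); helper file (`--supports stmt-CriticalPhenomena-4575`).

* `W0root` — the root law restricted to the root world `U = Q_{a₀,0} ∪ E_{a₀,0,du}`;
* `W0sub U'`, **`hQ0_of_chain_sub`** — the same with the law restricted to a sub-world `U' ⊆ Q_0 ∪ E_{0,du}` containing the root (the
  fibre tube of the instance; restriction only lowers the inside-connection probability);
* **`hQ0_of_chain`** — a linked chain of target steps (any auxiliary graph `G'`, e.g. the tube graph) with common source `root`, kits under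
  `W0root`, true targets inside enlarged ones with excess `≤ η ≤ δ/2`, a chain property at output accuracy `ε'' ≤ δc`, the source bound
  `1 - δ < P_{W0root}((s 0).reachB)` and the last true target inside `M_{a₀}(0 + du)` give the `du`-conjunct of `hQ0`.
[cite: KozmaNitzan2024, §4 p. 27 (G₀), p. 28 ((32) at the root), Lemma 12 (pp. 23–25)]
-/

noncomputable section

open MeasureTheory ProbabilityTheory
open scoped ENNReal Classical

namespace Summit.CriticalPhenomena.PercolationContinuityZ3.Theorems

namespace Transplant

namespace KNCells

open Literature.Probability.Percolation Literature.Probability.LatticeModels SimpleGraph GadgetSystem ProbeHistory HSiteScheme Contour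

variable {V : Type*} [DecidableEq V] [Countable V]

namespace KSchA

variable {A : Type*} (G : SimpleGraph V) [G.LocallyFinite] (S : KSchA V A)

/-- **The root world** of direction `du`: `Q_{a₀,0} ∪ E_{a₀,0,du}`. [cite: KozmaNitzan2024, §4 p. 28 ((32) at the root)] -/
def U0root (du : MDir) : Finset V := S.Γ.Q S.Γ.a₀ 0 ∪ S.Γ.Ewv S.Γ.a₀ 0 du

/-- **The root law restricted to the root world**: the graph weighting with the root cube's edges wired, restricted to `Q_0 ∪ E_{0,du}`.
[cite: KozmaNitzan2024, §4 p. 27 (G₀), p. 28] -/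
def W0root (du : MDir) : Sym2 V → unitInterval :=
  restrW (↑(S.U0root du) : Set V) (pinW (KNLevels.lattW G S.p) ↑(S.U₀ G) ↑(S.U₀ G))

variable {G S}

/-- **THE ROOT PROBE INPUT FROM A CHAIN** (design (D), D8). [cite: KozmaNitzan2024, §4 p. 28 ((32) at the root), Lemma 12] -/
theorem hQ0_of_chain (G' : SimpleGraph V) [G'.LocallyFinite] {du : MDir} {Δ' : ℕ} {δ ε'' η : ℝ} {n : ℕ} (hε : ε'' ≤ S.δc)
    (hchain : ∀ (W : Sym2 V → unitInterval) (s : Fin (n + 1) → KNLevels.TStep G') (T' : Fin (n + 1) → Finset V) (η : ℝ),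
      (∀ i : Fin (n + 1), (s i).L.o = (s 0).L.o) →
      (∀ i : Fin n, T' (Fin.castSucc i) ⊆ (s i.succ).L.X 0) →
      (∀ i : Fin (n + 1), T' i ⊆ (s i).T) →
      (∀ i : Fin (n + 1), (s i).KitsAt W S.p Δ' δ) →
      η ≤ δ / 2 →
      (∀ i : Fin (n + 1), (prodBernoulli W).real (⋃ t ∈ (s i).T \ T' i, openConn (s 0).L.o t) ≤ η) →
      1 - δ < (prodBernoulli W).real (s 0).L.reachB →
        1 - ε'' < (prodBernoulli W).real (⋃ t ∈ T' (Fin.last n), openConn (s 0).L.o t))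
    (s : Fin (n + 1) → KNLevels.TStep G') (T' : Fin (n + 1) → Finset V) (ho : ∀ i : Fin (n + 1), (s i).L.o = S.Γ.root)
    (hlink : ∀ i : Fin n, T' (Fin.castSucc i) ⊆ (s i.succ).L.X 0) (hsub : ∀ i : Fin (n + 1), T' i ⊆ (s i).T)
    (hkits : ∀ i : Fin (n + 1), (s i).KitsAt (S.W0root G du) S.p Δ' δ) (hη : η ≤ δ / 2)
    (hexc : ∀ i : Fin (n + 1), (prodBernoulli (S.W0root G du)).real (⋃ t ∈ (s i).T \ T' i, openConn S.Γ.root t) ≤ η)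
    (hsrc : 1 - δ < (prodBernoulli (S.W0root G du)).real (s 0).L.reachB) (hroot : S.Γ.root ∈ S.U0root du)
    (hTn : T' (Fin.last n) ⊆ S.Γ.M S.Γ.a₀ ((0 : Site 2) + stepVec du)) :
    1 - S.δc < (prodBernoulli (pinW (KNLevels.lattW G S.p) ↑(S.U₀ G) ↑(S.U₀ G))).real
      (⋃ t ∈ (↑(S.Γ.M S.Γ.a₀ ((0 : Site 2) + stepVec du)) : Set V),
        openConnIn (↑(S.Γ.Q S.Γ.a₀ 0 ∪ S.Γ.Ewv S.Γ.a₀ 0 du) : Set V) S.Γ.root t) := by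
  have ho' : ∀ i : Fin (n + 1), (s i).L.o = (s 0).L.o := fun i => by rw [ho i, ho 0]
  have hexc' : ∀ i : Fin (n + 1), (prodBernoulli (S.W0root G du)).real (⋃ t ∈ (s i).T \ T' i, openConn (s 0).L.o t) ≤ η :=
    fun i => by rw [ho 0]; exact hexc i
  have hc := hchain _ s T' η ho' hlink hsub hkits hη hexc' hsrc
  rw [ho 0, W0root, ← Finset.set_biUnion_coe, prodBernoulli_restrW_real_biUnion_openConn _ _ (Finset.mem_coe.2 hroot)] at hc
  have hc' : 1 - S.δc < (prodBernoulli (pinW (KNLevels.lattW G S.p) ↑(S.U₀ G) ↑(S.U₀ G))).real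
      (⋃ t ∈ (↑(T' (Fin.last n)) : Set V), openConnIn (↑(S.U0root du) : Set V) S.Γ.root t) := by linarith
  refine hc'.trans_le (measureReal_mono ?_ (measure_ne_top _ _))
  rw [U0root]
  exact biUnion_openConnIn_mono subset_rfl _ (Finset.coe_subset.2 hTn)

/-! ## The root law restricted to a sub-world (for the tube graph) -/

section Sub

variable (G S)

/-- **The root law restricted to a sub-world `U'`** (e.g. the root world cut to a fibre tube): the graph weighting with the root cube's edges
wired, restricted to the pairs inside `U'`. [cite: KozmaNitzan2024, §4 p. 28] -/
def W0sub (U' : Finset V) : Sym2 V → unitInterval :=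
  restrW (↑U' : Set V) (pinW (KNLevels.lattW G S.p) ↑(S.U₀ G) ↑(S.U₀ G))

variable {G S}

/-- **THE ROOT PROBE INPUT FROM A CHAIN IN A SUB-WORLD** `U' ⊆ Q_{a₀,0} ∪ E_{a₀,0,du}` containing the root (restricting the world only lowers the
certified inside-connection probability). [cite: KozmaNitzan2024, §4 p. 28 ((32) at the root), Lemma 12] -/
theorem hQ0_of_chain_sub (G' : SimpleGraph V) [G'.LocallyFinite] {du : MDir} {U' : Finset V} (hU' : U' ⊆ S.U0root du) (hroot : S.Γ.root ∈ U')
    {Δ' : ℕ} {δ ε'' η : ℝ} {n : ℕ} (hε : ε'' ≤ S.δc)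
    (hchain : ∀ (W : Sym2 V → unitInterval) (s : Fin (n + 1) → KNLevels.TStep G') (T' : Fin (n + 1) → Finset V) (η : ℝ),
      (∀ i : Fin (n + 1), (s i).L.o = (s 0).L.o) →
      (∀ i : Fin n, T' (Fin.castSucc i) ⊆ (s i.succ).L.X 0) →
      (∀ i : Fin (n + 1), T' i ⊆ (s i).T) →
      (∀ i : Fin (n + 1), (s i).KitsAt W S.p Δ' δ) →
      η ≤ δ / 2 →
      (∀ i : Fin (n + 1), (prodBernoulli W).real (⋃ t ∈ (s i).T \ T' i, openConn (s 0).L.o t) ≤ η) →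
      1 - δ < (prodBernoulli W).real (s 0).L.reachB →
        1 - ε'' < (prodBernoulli W).real (⋃ t ∈ T' (Fin.last n), openConn (s 0).L.o t))
    (s : Fin (n + 1) → KNLevels.TStep G') (T' : Fin (n + 1) → Finset V) (ho : ∀ i : Fin (n + 1), (s i).L.o = S.Γ.root)
    (hlink : ∀ i : Fin n, T' (Fin.castSucc i) ⊆ (s i.succ).L.X 0) (hsub : ∀ i : Fin (n + 1), T' i ⊆ (s i).T)
    (hkits : ∀ i : Fin (n + 1), (s i).KitsAt (S.W0sub G U') S.p Δ' δ) (hη : η ≤ δ / 2)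
    (hexc : ∀ i : Fin (n + 1), (prodBernoulli (S.W0sub G U')).real (⋃ t ∈ (s i).T \ T' i, openConn S.Γ.root t) ≤ η)
    (hsrc : 1 - δ < (prodBernoulli (S.W0sub G U')).real (s 0).L.reachB)
    (hTn : T' (Fin.last n) ⊆ S.Γ.M S.Γ.a₀ ((0 : Site 2) + stepVec du)) :
    1 - S.δc < (prodBernoulli (pinW (KNLevels.lattW G S.p) ↑(S.U₀ G) ↑(S.U₀ G))).real
      (⋃ t ∈ (↑(S.Γ.M S.Γ.a₀ ((0 : Site 2) + stepVec du)) : Set V),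
        openConnIn (↑(S.Γ.Q S.Γ.a₀ 0 ∪ S.Γ.Ewv S.Γ.a₀ 0 du) : Set V) S.Γ.root t) := by
  have ho' : ∀ i : Fin (n + 1), (s i).L.o = (s 0).L.o := fun i => by rw [ho i, ho 0]
  have hexc' : ∀ i : Fin (n + 1), (prodBernoulli (S.W0sub G U')).real (⋃ t ∈ (s i).T \ T' i, openConn (s 0).L.o t) ≤ η :=
    fun i => by rw [ho 0]; exact hexc i
  have hc := hchain _ s T' η ho' hlink hsub hkits hη hexc' hsrc
  rw [ho 0, W0sub, ← Finset.set_biUnion_coe, prodBernoulli_restrW_real_biUnion_openConn _ _ (Finset.mem_coe.2 hroot)] at hc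
  have hc' : 1 - S.δc < (prodBernoulli (pinW (KNLevels.lattW G S.p) ↑(S.U₀ G) ↑(S.U₀ G))).real
      (⋃ t ∈ (↑(T' (Fin.last n)) : Set V), openConnIn (↑U' : Set V) S.Γ.root t) := by linarith
  refine hc'.trans_le (measureReal_mono ?_ (measure_ne_top _ _))
  have hU'' : (↑U' : Set V) ⊆ ↑(S.Γ.Q S.Γ.a₀ 0 ∪ S.Γ.Ewv S.Γ.a₀ 0 du) := by
    rw [← U0root]; exact Finset.coe_subset.2 hU'
  exact biUnion_openConnIn_mono hU'' _ (Finset.coe_subset.2 hTn)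

end Sub

end KSchA

end KNCells

end Transplant

end Summit.CriticalPhenomena.PercolationContinuityZ3.Theorems

end
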